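import Literature.NumberTheory.BeurlingPrimes.LiSeries
import Mathlib.NumberTheory.LSeries.Dirichlet
import HarnessLib

/-!
# `1/ζ(m) = Σ μ(k)/k^m` and its finite Möbius approximations (coefficients of `li(x^z)`)

Topic `Literature/NumberTheory/BeurlingPrimes`. Everything in this file is PROVED (theorems only).

Broucke–Debruyne–Révész (2023, §2) expand `x log x (d/dx) li(x^z) = Σ_{k≥1} (μ(k)/k)(x^{z/k} − 1) =
Σ_{n≥1} zⁿ(log x)ⁿ/(n! ζ(n+1))` ((2.5)–(2.6)) and, in the proof of Lemma 3.1, estimate it by splitting the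
Möbius sum at `k ≈ Q log x`. For complex `z` the infinite interchange of the two sums can be avoided by
splitting instead the COEFFICIENTS `1/ζ(n+1) = Σ_{k ≤ K} μ(k)/k^{n+1} + O(K^{−n})` at a fixed `K` (chosen with
`K ≥ 2|z|` later). With the tree's `zetaN m = Σ_{k≥1} k^{−m}` (`LiSeries.lean`) this file provides:

* `ofReal_zetaN` — `zetaN m = ζ(m)` in `ℂ` (`m ≥ 2`); `inv_zetaN_pos`, `inv_zetaN_le_one`, `half_le_inv_zetaN`
  (`1/2 ≤ 1/ζ(m) ≤ 1`, as in BDR (2.7): "`1/ζ(n+1) ≥ 1/ζ(2)`, `> δ/(2x)`");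
* `hasSum_moebius_div_pow` — **`Σ_{k} μ(k)/k^m = 1/ζ(m)`** in `ℝ` (`m ≥ 2`; Mathlib's `LSeries_one_mul_Lseries_moebius`);
* `abs_inv_zetaN_sub_sum_le` — **`|1/ζ(m) − Σ_{k=0}^{K} μ(k)/k^m| ≤ K^{1−m}`** (`K ≥ 1`, `m ≥ 2`), from `|μ| ≤ 1` and the
  telescoping tail bound `Σ_{k>K} k^{−m} ≤ K^{2−m} Σ_{k>K} (1/(k−1) − 1/k) = K^{1−m}` (`tsum_one_div_pow_tail_le`).

## References
* [BrouckeDebruyneRevesz2023] F. Broucke, G. Debruyne, Sz. Gy. Révész, *Some examples of well-behaved Beurling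
  number systems*, arXiv:2309.01567, §2 (2.2)–(2.7) and proof of Lemma 3.1 (read).
-/

noncomputable section

open Filter Topology ArithmeticFunction
open scoped LSeries.notation ArithmeticFunction.Moebius

namespace Literature.NumberTheory.BeurlingPrimes

variable {m : ℕ}

/-! ### `zetaN m = ζ(m)` and `1/2 ≤ 1/ζ(m) ≤ 1` -/

/-- Summability of `k ↦ 1/k^m` over all `k : ℕ` (the `k = 0` term is `0`) for `m ≥ 2`. [folklore] -/
theorem summable_one_div_natCast_pow (hm : 2 ≤ m) : Summable fun k : ℕ ↦ 1 / (k : ℝ) ^ m :=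
  Real.summable_one_div_nat_pow.mpr (by omega)

/-- `zetaN m` as the sum over all `k : ℕ` (the `k = 0` term vanishes for `m ≥ 1`). [folklore] -/
theorem zetaN_eq_tsum (hm : 2 ≤ m) : zetaN m = ∑' k : ℕ, 1 / (k : ℝ) ^ m := by
  rw [(summable_one_div_natCast_pow hm).tsum_eq_zero_add, zetaN]
  simp [zero_pow (by omega : m ≠ 0)]

/-- **`zetaN m = ζ(m)`** in `ℂ` for `m ≥ 2`. [folklore] -/
theorem ofReal_zetaN (hm : 2 ≤ m) : (zetaN m : ℂ) = riemannZeta m := by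
  rw [zeta_nat_eq_tsum_of_gt_one (by omega : 1 < m), zetaN_eq_tsum hm, Complex.ofReal_tsum]
  refine tsum_congr fun k ↦ ?_
  push_cast
  rfl

/-- `0 < 1/ζ(m)` (`m ≥ 2`). [cite: BrouckeDebruyneRevesz2023, §2 (2.7)] -/
theorem inv_zetaN_pos (hm : 2 ≤ m) : 0 < (zetaN m)⁻¹ := inv_pos.2 (zetaN_pos hm)

/-- `1/ζ(m) ≤ 1` (`m ≥ 2`). [cite: BrouckeDebruyneRevesz2023, §2] -/
theorem inv_zetaN_le_one (hm : 2 ≤ m) : (zetaN m)⁻¹ ≤ 1 := inv_le_one_of_one_le₀ (one_le_zetaN hm)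

/-- `ζ(m) ≤ 2` (`m ≥ 2`). [folklore] -/
theorem zetaN_le_two (hm : 2 ≤ m) : zetaN m ≤ 2 := by
  have h1 := zetaN_sub_one_le hm
  have h2 : (1 / 2 : ℝ) ^ (m - 2) ≤ 1 := pow_le_one₀ (by norm_num) (by norm_num)
  linarith

/-- **`1/2 ≤ 1/ζ(m)`** (`m ≥ 2`): `ζ(m) ≤ ζ(2) ≤ 2` (BDR (2.7): "`≥ (1/ζ(2)) … > δ/(2x)`").
[cite: BrouckeDebruyneRevesz2023, §2 (2.7)] -/
theorem half_le_inv_zetaN (hm : 2 ≤ m) : 1 / 2 ≤ (zetaN m)⁻¹ := by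
  rw [one_div]
  exact (inv_le_inv₀ two_pos (zetaN_pos hm)).2 (zetaN_le_two hm)

/-- `|1/ζ(m)| ≤ 1` (`m ≥ 2`). [folklore] -/
theorem abs_inv_zetaN_le_one (hm : 2 ≤ m) : |(zetaN m)⁻¹| ≤ 1 := by
  rw [abs_of_pos (inv_zetaN_pos hm)]; exact inv_zetaN_le_one hm

/-! ### The Möbius series `Σ μ(k)/k^m = 1/ζ(m)` -/

/-- The complex `L`-series term of `μ` at `s = m` is the real number `μ(k)/k^m`. [folklore] -/
theorem term_moebius_eq (m k : ℕ) :
    LSeries.term (fun n : ℕ ↦ ((μ n : ℤ) : ℂ)) (m : ℂ) k = (((μ k : ℝ) / (k : ℝ) ^ m : ℝ) : ℂ) := by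
  rcases Nat.eq_zero_or_pos k with rfl | hk
  · simp [LSeries.term]
  · rw [LSeries.term_of_ne_zero hk.ne', Complex.cpow_natCast]
    push_cast
    rfl

/-- **`Σ_{k} μ(k)/k^m = 1/ζ(m)`** for `m ≥ 2`, as a real series (the `k = 0` term is `0`): the Dirichlet series
identity `ζ(s) · Σ μ(k)k^{−s} = 1` (Mathlib `LSeries_one_mul_Lseries_moebius`) at `s = m`, read in `ℝ`.
[cite: BrouckeDebruyneRevesz2023, §2 (2.2)] -/
theorem hasSum_moebius_div_pow (hm : 2 ≤ m) :
    HasSum (fun k : ℕ ↦ (μ k : ℝ) / (k : ℝ) ^ m) (zetaN m)⁻¹ := by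
  have hs : 1 < (m : ℂ).re := by simp; omega
  have hsum : LSeriesSummable (fun n : ℕ ↦ ((μ n : ℤ) : ℂ)) (m : ℂ) := LSeriesSummable_moebius_iff.mpr hs
  have hmul := LSeries_one_mul_Lseries_moebius hs
  rw [LSeries_one_eq_riemannZeta hs] at hmul
  have hz : riemannZeta (m : ℂ) ≠ 0 := riemannZeta_ne_zero_of_one_lt_re hs
  have hval : LSeries (fun n : ℕ ↦ ((μ n : ℤ) : ℂ)) (m : ℂ) = (((zetaN m)⁻¹ : ℝ) : ℂ) := by
    have : LSeries (fun n : ℕ ↦ ((μ n : ℤ) : ℂ)) (m : ℂ) = (riemannZeta (m : ℂ))⁻¹ := by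
      field_simp
      rw [mul_comm]; exact hmul
    rw [this, Complex.ofReal_inv, ofReal_zetaN hm]
  have h : HasSum (LSeries.term (fun n : ℕ ↦ ((μ n : ℤ) : ℂ)) (m : ℂ)) (((zetaN m)⁻¹ : ℝ) : ℂ) :=
    hval ▸ hsum.hasSum
  have hre := Complex.hasSum_re h
  simp only [term_moebius_eq, Complex.ofReal_re] at hre
  exact hre

/-- Summability of `k ↦ μ(k)/k^m` (`m ≥ 2`). [folklore] -/
theorem summable_moebius_div_pow (hm : 2 ≤ m) : Summable fun k : ℕ ↦ (μ k : ℝ) / (k : ℝ) ^ m :=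
  (hasSum_moebius_div_pow hm).summable

/-! ### The tail bound `Σ_{k > K} k^{−m} ≤ K^{1−m}` and the finite Möbius approximation -/

/-- Telescoping bound for one term: `1/(K+1+j)^m ≤ K^{2−m} (1/(K+j) − 1/(K+1+j))` for `K ≥ 1`, `m ≥ 2`
(`k^{−m} ≤ K^{2−m}/((k−1)k)` for `k > K`). [folklore] -/
theorem one_div_pow_le_telescope (hm : 2 ≤ m) {K : ℕ} (hK : 1 ≤ K) (j : ℕ) :
    1 / ((K + 1 + j : ℕ) : ℝ) ^ m ≤
      ((K : ℝ) ^ (m - 2))⁻¹ * (1 / ((K + j : ℕ) : ℝ) - 1 / ((K + 1 + j : ℕ) : ℝ)) := by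
  have hK0 : (0 : ℝ) < K := by exact_mod_cast hK
  have ha : (0 : ℝ) < (K + j : ℕ) := by push_cast; positivity
  have hb : (0 : ℝ) < (K + 1 + j : ℕ) := by push_cast; positivity
  have hab : ((K + 1 + j : ℕ) : ℝ) = (K + j : ℕ) + 1 := by push_cast; ring
  -- `1/(a) - 1/(a+1) = 1/(a(a+1))`
  have htel : 1 / ((K + j : ℕ) : ℝ) - 1 / ((K + 1 + j : ℕ) : ℝ) = 1 / (((K + j : ℕ) : ℝ) * ((K + 1 + j : ℕ) : ℝ)) := by
    rw [hab]; field_simp; ring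
  rw [htel]
  -- `b^m = b^(m-2) * b * b ≥ K^(m-2) * a * b`
  obtain ⟨n, rfl⟩ : ∃ n, m = n + 2 := ⟨m - 2, by omega⟩
  simp only [Nat.add_sub_cancel]
  set a : ℝ := ((K + j : ℕ) : ℝ) with ha_def
  set b : ℝ := ((K + 1 + j : ℕ) : ℝ) with hb_def
  have hKb : (K : ℝ) ≤ b := by rw [hb_def]; push_cast; linarith
  have haleb : a ≤ b := by rw [hab]; linarith
  have hpow : (K : ℝ) ^ n ≤ b ^ n := pow_le_pow_left₀ hK0.le hKb n
  have key : (K : ℝ) ^ n * a * b ≤ b ^ n * b * b := by gcongr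
  calc 1 / b ^ (n + 2) = 1 / (b ^ n * b * b) := by ring_nf
    _ ≤ 1 / ((K : ℝ) ^ n * a * b) := one_div_le_one_div_of_le (by positivity) key
    _ = ((K : ℝ) ^ n)⁻¹ * (1 / (a * b)) := by rw [one_div, one_div, mul_assoc, mul_inv]

/-- **Tail bound**: `Σ_{j ≥ 0} 1/(K+1+j)^m ≤ K^{1−m}` for `K ≥ 1`, `m ≥ 2` (i.e. `Σ_{k > K} k^{−m} ≤ K^{1−m}`).
[cite: BrouckeDebruyneRevesz2023, proof of Lemma 3.1] -/
theorem tsum_one_div_pow_tail_le (hm : 2 ≤ m) {K : ℕ} (hK : 1 ≤ K) :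
    ∑' j : ℕ, 1 / ((K + 1 + j : ℕ) : ℝ) ^ m ≤ ((K : ℝ) ^ (m - 1))⁻¹ := by
  have hK0 : (0 : ℝ) < K := by exact_mod_cast hK
  -- summability of the tail
  have hs : Summable fun j : ℕ ↦ 1 / ((K + 1 + j : ℕ) : ℝ) ^ m := by
    have h := (summable_nat_add_iff (f := fun k : ℕ ↦ 1 / (k : ℝ) ^ m) (K + 1)).mpr
      (summable_one_div_natCast_pow hm)
    refine h.congr fun j ↦ ?_
    simp only [Nat.cast_add, Nat.cast_one]
    ring_nf
  -- partial sums are bounded by the telescoping sums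
  refine hs.tsum_le_of_sum_range_le (fun N ↦ ?_)
  have htel : ∀ N : ℕ, ∑ j ∈ Finset.range N, (1 / ((K + j : ℕ) : ℝ) - 1 / ((K + 1 + j : ℕ) : ℝ)) =
      1 / (K : ℝ) - 1 / ((K + N : ℕ) : ℝ) := by
    intro N
    induction N with
    | zero => simp
    | succ N ih =>
      rw [Finset.sum_range_succ, ih]
      have : ((K + 1 + N : ℕ) : ℝ) = ((K + (N + 1) : ℕ) : ℝ) := by push_cast; ring
      rw [this]
      ring
  calc ∑ j ∈ Finset.range N, 1 / ((K + 1 + j : ℕ) : ℝ) ^ m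
      ≤ ∑ j ∈ Finset.range N, ((K : ℝ) ^ (m - 2))⁻¹ * (1 / ((K + j : ℕ) : ℝ) - 1 / ((K + 1 + j : ℕ) : ℝ)) :=
        Finset.sum_le_sum fun j _ ↦ one_div_pow_le_telescope hm hK j
    _ = ((K : ℝ) ^ (m - 2))⁻¹ * (1 / (K : ℝ) - 1 / ((K + N : ℕ) : ℝ)) := by rw [← Finset.mul_sum, htel]
    _ ≤ ((K : ℝ) ^ (m - 2))⁻¹ * (1 / (K : ℝ)) := by
        refine mul_le_mul_of_nonneg_left ?_ (by positivity)
        have : 0 ≤ 1 / ((K + N : ℕ) : ℝ) := by positivity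
        linarith
    _ = ((K : ℝ) ^ (m - 1))⁻¹ := by
        obtain ⟨n, rfl⟩ : ∃ n, m = n + 2 := ⟨m - 2, by omega⟩
        simp only [Nat.add_sub_cancel, show n + 2 - 1 = n + 1 by omega, pow_succ]
        field_simp

/-- **The finite Möbius approximation of `1/ζ(m)`**: for `K ≥ 1` and `m ≥ 2`,
`|1/ζ(m) − Σ_{k=0}^{K} μ(k)/k^m| ≤ K^{1−m}` (the `k = 0` term vanishes). This is the splitting of the Möbius sum
in the proof of BDR Lemma 3.1, with the tail controlled by `|μ| ≤ 1`.
[cite: BrouckeDebruyneRevesz2023, proof of Lemma 3.1] -/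
theorem abs_inv_zetaN_sub_sum_le (hm : 2 ≤ m) {K : ℕ} (hK : 1 ≤ K) :
    |(zetaN m)⁻¹ - ∑ k ∈ Finset.range (K + 1), (μ k : ℝ) / (k : ℝ) ^ m| ≤ ((K : ℝ) ^ (m - 1))⁻¹ := by
  have h := hasSum_moebius_div_pow hm
  have htail := (hasSum_nat_add_iff' (K + 1)).mpr h
  -- `1/ζ(m) − Σ_{k ≤ K} = Σ_j μ(K+1+j)/(K+1+j)^m`
  rw [← htail.tsum_eq]
  have hs1 : Summable fun j : ℕ ↦ 1 / ((K + 1 + j : ℕ) : ℝ) ^ m := by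
    have h2 := (summable_nat_add_iff (f := fun k : ℕ ↦ 1 / (k : ℝ) ^ m) (K + 1)).mpr
      (summable_one_div_natCast_pow hm)
    refine h2.congr fun j ↦ ?_
    simp only [Nat.cast_add, Nat.cast_one]
    ring_nf
  have hle : ∀ j : ℕ, ‖(μ (j + (K + 1)) : ℝ) / ((j + (K + 1) : ℕ) : ℝ) ^ m‖ ≤ 1 / ((K + 1 + j : ℕ) : ℝ) ^ m := by
    intro j
    rw [Real.norm_eq_abs, abs_div, abs_pow, Nat.abs_cast, show j + (K + 1) = K + 1 + j by ring]
    refine div_le_div_of_nonneg_right ?_ (by positivity)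
    exact_mod_cast abs_moebius_le_one
  calc |∑' j : ℕ, (μ (j + (K + 1)) : ℝ) / ((j + (K + 1) : ℕ) : ℝ) ^ m|
      ≤ ∑' j : ℕ, 1 / ((K + 1 + j : ℕ) : ℝ) ^ m := by
        have := tsum_of_norm_bounded hs1.hasSum hle
        simpa [Real.norm_eq_abs] using this
    _ ≤ ((K : ℝ) ^ (m - 1))⁻¹ := tsum_one_div_pow_tail_le hm hK

end Literature.NumberTheory.BeurlingPrimes
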